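import Summits.BirchSwinnertonDyer.Rank1Residual.GaloisImage.ExoticThreeAdicImage
import Literature.NumberTheory.EllipticCurves.SerreOpenImageDeterminantProofs
import Literature.NumberTheory.EllipticCurves.NonEisensteinPrimeOfSurjective
import Literature.NumberTheory.EllipticCurves.WeilPairingProofs
import Literature.NumberTheory.GaloisRepresentations.CyclotomicLevels
import HarnessLib

/-!
# surj(p), `p` odd ⟹ a transvection `τ ∈ [Γ_ℚ, Γ_ℚ]` on `E[p]`: Mazur–Rubin (H.2) / Rubin's
# `Hyp(ℚ, E[p])` for the RESIDUAL representation on EVERY surj(3) row, EXOTIC rows included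
# (cell `b2b-bsdres`, team n1011, sub-target T-a5x (hypothesis side); §I item N11; seat p13)

HONEST FRAMING (cell `b2b-bsdres`, run/shared/lean/b2b/bsd-rank1-residual/, verbatim in every
file): the goal of the cell is to DELETE the COMBINATION-SHAPED residual classes of the
Birch–Swinnerton-Dyer formula for ALL analytic-rank `≤ 1` elliptic curves over `ℚ` — "full BSD
formula for every rank `≤ 1` curve in class `C`" assembled STRICTLY from published theorems — so
that the rank-`≤ 1` remainder becomes exactly the CONSTRUCTION-SHAPED classes, which are TYPED
(missing-input `Prop`s), NOT attempted. This is not "finishing BSD". Team n1011: prove what is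
provable now; shrink each hard class to its core with data; no claim beyond stated classes. Theorems
only (no definition, no named fact); nothing is booked; no label changes. A TOOL file about the
Galois module `E[p]`.

## What and why

Every Kolyvagin-system argument over `ℚ` (Mazur–Rubin, Mem. AMS 799 (2004) §3.5 (H.2); Rubin,
*Euler Systems* `Hyp(ℚ, T)` (a); Sakamoto, JTNB 36 (2024) §2 (H.2); Kato, Astérisque 295 Thm. 13.4
(3); BCS 2025 (im)) wants an element `τ ∈ G_{ℚ(μ_{p^∞})}` with `T/(τ − 1)T` free of rank one. For
`T = T_pE` / `T = E[p^m]`, `m ≥ 2`, this is the cell predicate `Rank1Residual.BigIm W p`, which on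
the EXOTIC rows of N11 (surj(3) ∧ ¬surj(9), Elkies' `9`-deficient family) FAILS
(`not_bigIm_of_surj_three_of_not_surj_nine`, file `ExoticThreeAdicImage`). This file proves that for
the RESIDUAL representation `T̄ = E[p]` (coefficients `𝔽_p`, Sakamoto's `α = 1`, Mazur–Rubin's
`k = 1`) the hypothesis holds from surj(p) ALONE, for every odd prime `p`, with a `τ` in the
COMMUTATOR subgroup of `Γ_ℚ` — so `τ` fixes every root of unity of every order (`ℚ(μ_N)/ℚ` is
abelian: tree `commutator_le_rootsOfUnityFixer`), in particular `τ ∈ G_{ℚ(μ_{p^∞})}`: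

* `exists_mem_commutator_frame_shear_of_surj` — `p` odd, `ρ̄_{E,p}` onto ⟹ there are a frame
  `e : E[p] ≃+ 𝔽_p²` and `τ ∈ [Γ_ℚ, Γ_ℚ]` acting in that frame by the transvection `(1 1; 0 1)`.
  Proof: in `GL₂(𝔽_p)` one has `⁅diag(2, 1), (1 1; 0 1)⁆ = (1 1; 0 1)^{2−1} = (1 1; 0 1)` (`2 ∈ 𝔽_pˣ`,
  `p` odd); pull `diag(2,1)` and `(1 1; 0 1)` back along the surjection `Φ ∘ ρ̄_{E,p} : Γ_ℚ ↠ GL₂(𝔽_p)`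
  (frame `exists_frame_galoisRepTorsion_rat`) to `g, h ∈ Γ_ℚ`; then `τ = ⁅g, h⁆`.
* `exists_mem_commutator_transvection_of_surj` — frame-free: some `τ ∈ [Γ_ℚ, Γ_ℚ]` acts on `E[p]`
  with `(τ − 1)² = 0`, `τ ≠ 1`;
* `exists_mem_commutator_torsion_quotient_equiv_zmod_of_surj` — hence `E[p]/(τ − 1)E[p] ≃+ ℤ/p`
  with `τ ∈ [Γ_ℚ, Γ_ℚ]`; `exists_rootsOfUnityFixing_torsion_quotient_equiv_zmod_of_surj` — the same
  `τ` fixes every `t ∈ ℚ̄` with `t^N = 1`, every `N ≥ 1`; `exists_torsion_quotient_equiv_zmod_of_surj`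
  — the `p`-power form, i.e. literally the level-`1` case of the (H.2) shape of
  `BigImTorsionLevels.exists_torsion_quotient_equiv_zmod_of_towerSurj`, now WITHOUT the tower.
* `residualHypotheses_of_surj` — **(H.1) ∧ (H.2)_{T̄} ∧ (H.SD) for `(E[p], 𝔽_p)` from surj(p), `p`
  odd** (irreducibility; the `τ` above; the Weil pairing `E[p] ≅ E[p]^∨(1)`, tree theorem
  `exists_weilPairing_holds`); `residualHypotheses_three_of_surj` — the N11 instance: on EVERY
  N11 row (N11 = X4 ∧ r_an = 0 ∧ p = 3 ∧ surj(3), locus-free);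
  `residualHypotheses_and_not_bigIm_of_exotic` — on an EXOTIC row the level-`1` hypotheses HOLD
  while (im) FAILS: the Elkies corner obstructs the printed machinery only through levels `k ≥ 2`
  (`E[9]`, `T₃E`), not at level `1` (`E[3]`) — the kernel form of the seat's EXOTIC-LEVEL-NOTE F1,
  curve-level and without the Elkies group.

What is NOT here: no statement about Kolyvagin systems themselves (T-a3-F1 Stage 2 vocabulary,
`Literature/NumberTheory/GaloisCohomology/KolyvaginSystems.lean`, is review-queued), no bound on a
Selmer group, nothing conditional; (H.3) at level `1` (`H¹(ℚ(E[3])/ℚ, E[3]) = 0`, Sah with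
`−1 ∈ GL₂(𝔽₃)`) is the x11b3 `X11b/Three/ImageSah.lean` file's business and is not restated. New
content is at `p = 3` only: for `p ≥ 5`, surj(p) gives the whole tower (Serre) and
`X9/SurjBigImage.bigIm_of_surj` the adic (im); at `p = 2` the statement is false (`GL₂(𝔽₂) ≅ S₃` has
commutator subgroup `A₃`, which contains no transvection).

References: B. Mazur, K. Rubin, Mem. AMS 799 (2004) §3.5 (H.2); K. Rubin, *Euler Systems*, Ann. of
Math. Stud. 147 (2000) §2.1 `Hyp(K, T)`; R. Sakamoto, JTNB 36 (2024) §2 (H.2) (p. 921)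
[Sakamoto2024]; J.-P. Serre, Invent. Math. 15 (1972) §5.2 (the framed mod-`p` representation)
[Serre1972]; J. H. Silverman, *AEC* III.8.1 (Weil pairing) [SilvermanAEC2009]; N. D. Elkies,
arXiv:math/0612734 (2006) (the `9`-deficient family).
-/

noncomputable section

open scoped Classical commutatorElement
open Field Matrix
open WeierstrassCurve Literature.NumberTheory.EllipticCurves Literature.NumberTheory.GaloisRepresentations
  Literature.NumberTheory.EllipticCurves.Rank1Residual

namespace Summit.BirchSwinnertonDyer.Rank1Residual.GaloisImage

/-! ### The `GL₂` identity `⁅diag(2,1), (1 1; 0 1)⁆ = (1 1; 0 1)` -/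

section GL2

variable {K : Type*} [Field K]

/-- In `GL₂(K)` with `2 ≠ 0`: the commutator of `diag(2, 1)` and the elementary transvection
`u = (1 1; 0 1)` is `u` itself (`diag(a,1) u diag(a,1)⁻¹ = u^a`, so `⁅diag(a,1), u⁆ = u^{a−1}`;
`a = 2`). In particular `u` lies in the commutator subgroup of `GL₂(K)`. [folklore] -/
theorem GL2.commutatorElement_diagTwo_shear (h2 : (2 : K) ≠ 0) :
    ⁅Matrix.GeneralLinearGroup.mkOfDetNeZero !![(2 : K), 0; 0, 1]
        (by rw [Matrix.det_fin_two_of]; simpa using h2),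
      Matrix.GeneralLinearGroup.mkOfDetNeZero !![(1 : K), 1; 0, 1]
        (by rw [Matrix.det_fin_two_of]; simp)⁆ =
      Matrix.GeneralLinearGroup.mkOfDetNeZero !![(1 : K), 1; 0, 1]
        (by rw [Matrix.det_fin_two_of]; simp) := by
  set A : GL (Fin 2) K := Matrix.GeneralLinearGroup.mkOfDetNeZero !![(2 : K), 0; 0, 1]
    (by rw [Matrix.det_fin_two_of]; simpa using h2) with hA
  set B : GL (Fin 2) K := Matrix.GeneralLinearGroup.mkOfDetNeZero !![(1 : K), 1; 0, 1]
    (by rw [Matrix.det_fin_two_of]; simp) with hB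
  have hAv : (A : Matrix (Fin 2) (Fin 2) K) = !![(2 : K), 0; 0, 1] := rfl
  have hBv : (B : Matrix (Fin 2) (Fin 2) K) = !![(1 : K), 1; 0, 1] := rfl
  have hAB : A * B = B * B * A := by
    apply Matrix.GeneralLinearGroup.ext
    intro i j
    rw [Matrix.GeneralLinearGroup.coe_mul, Matrix.GeneralLinearGroup.coe_mul,
      Matrix.GeneralLinearGroup.coe_mul, hAv, hBv]
    fin_cases i <;> fin_cases j <;> norm_num [Matrix.mul_apply, Fin.sum_univ_two]
  calc ⁅A, B⁆ = A * B * A⁻¹ * B⁻¹ := commutatorElement_def A B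
    _ = B * B * A * A⁻¹ * B⁻¹ := by rw [hAB]
    _ = B := by rw [mul_inv_cancel_right, mul_inv_cancel_right]

end GL2

/-! ### The transvection in the commutator subgroup -/

variable (W : WeierstrassCurve ℚ) [W.IsElliptic] (p : ℕ) [hp : Fact p.Prime]

/-- **surj(p), `p` odd ⟹ a transvection of `E[p]` realised by a COMMUTATOR of `Γ_ℚ`.** For an
elliptic curve `E = W/ℚ` and an odd prime `p` with `ρ̄_{E,p} : Γ_ℚ → Aut(E[p])` onto, there are an
additive frame `e : E[p] ≃+ 𝔽_p²` and `τ` in the commutator subgroup `[Γ_ℚ, Γ_ℚ]` acting in the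
frame by `(1 1; 0 1)`: `e(τ x)₀ = e(x)₀ + e(x)₁`, `e(τ x)₁ = e(x)₁`. Proof: frame
`exists_frame_galoisRepTorsion_rat` (`Φ : Aut(E[p]) ≅ GL₂(𝔽_p)`), lifts `g ↦ diag(2,1)`,
`h ↦ (1 1; 0 1)` along the surjection, `τ = ⁅g, h⁆ ↦ ⁅diag(2,1), (1 1;0 1)⁆ = (1 1; 0 1)`
(`GL2.commutatorElement_diagTwo_shear`). [cite: Serre1972, §5.2 (the framed mod-`p` representation)] -/
theorem exists_mem_commutator_frame_shear_of_surj (hp2 : p ≠ 2) (hs : Surj W p) :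
    ∃ (e : geomTorsion W p ≃+ (Fin 2 → ZMod p)) (τ : absoluteGaloisGroup ℚ),
      τ ∈ commutator (absoluteGaloisGroup ℚ) ∧
      ∀ x : geomTorsion W p, e (τ • x) 0 = e x 0 + e x 1 ∧ e (τ • x) 1 = e x 1 := by
  obtain ⟨e, Φ, he, -, -, -, -⟩ := exists_frame_galoisRepTorsion_rat W p
  have h2 : (2 : ZMod p) ≠ 0 := by
    intro h
    have h' : ((2 : ℕ) : ZMod p) = 0 := by exact_mod_cast h
    rw [ZMod.natCast_eq_zero_iff, Nat.prime_dvd_prime_iff_eq hp.out Nat.prime_two] at h'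
    exact hp2 h'
  set A : GL (Fin 2) (ZMod p) := Matrix.GeneralLinearGroup.mkOfDetNeZero !![(2 : ZMod p), 0; 0, 1]
    (by rw [Matrix.det_fin_two_of]; simpa using h2) with hA
  set B : GL (Fin 2) (ZMod p) := Matrix.GeneralLinearGroup.mkOfDetNeZero !![(1 : ZMod p), 1; 0, 1]
    (by rw [Matrix.det_fin_two_of]; simp) with hB
  have hBv : (B : Matrix (Fin 2) (Fin 2) (ZMod p)) = !![(1 : ZMod p), 1; 0, 1] := rfl
  have hcomm : ⁅A, B⁆ = B := GL2.commutatorElement_diagTwo_shear h2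
  -- lift `A` and `B` along `Φ ∘ ρ̄_{E,p}`
  obtain ⟨g, hg⟩ := hs (Φ.symm A)
  obtain ⟨h, hh⟩ := hs (Φ.symm B)
  have hΦg : Φ (galoisRepTorsion W p g) = A := by rw [hg, MulEquiv.apply_symm_apply]
  have hΦh : Φ (galoisRepTorsion W p h) = B := by rw [hh, MulEquiv.apply_symm_apply]
  refine ⟨e, ⁅g, h⁆, ?_, fun x => ?_⟩
  · rw [commutator_def]
    exact Subgroup.commutator_mem_commutator (Subgroup.mem_top g) (Subgroup.mem_top h)
  · have hΦτ : Φ (galoisRepTorsion W p ⁅g, h⁆) = B := by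
      rw [map_commutatorElement, map_commutatorElement, hΦg, hΦh, hcomm]
    have hx := he (galoisRepTorsion W p ⁅g, h⁆) x
    rw [galoisRepTorsion_apply, hΦτ, hBv] at hx
    have h0 := congrFun hx 0
    have h1 := congrFun hx 1
    simp [Matrix.mulVec, dotProduct, Fin.sum_univ_two] at h0 h1
    exact ⟨h0, h1⟩

/-- **Frame-free form: a non-trivial unipotent element of the image inside `[Γ_ℚ, Γ_ℚ]`.**
surj(p), `p` odd ⟹ some `τ` in the commutator subgroup of `Γ_ℚ` acts on `E[p]` with
`(τ − 1)² = 0` and `τ ≠ 1` — a transvection (in the frame of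
`exists_mem_commutator_frame_shear_of_surj`, `(τ − 1)x` has coordinates `(e(x)₁, 0)`, fixed by
`τ`, and the point with coordinates `(0, 1)` is moved). [cite: Serre1972, §5.2] -/
theorem exists_mem_commutator_transvection_of_surj (hp2 : p ≠ 2) (hs : Surj W p) :
    ∃ τ : absoluteGaloisGroup ℚ, τ ∈ commutator (absoluteGaloisGroup ℚ) ∧
      (∀ x : geomTorsion W p, τ • (τ • x - x) = τ • x - x) ∧
      ∃ x : geomTorsion W p, τ • x ≠ x := by
  obtain ⟨e, τ, hτ, hcoord⟩ := exists_mem_commutator_frame_shear_of_surj W p hp2 hs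
  have hp1 : (1 : ZMod p) ≠ 0 := by
    haveI : Fact (1 < p) := ⟨hp.out.one_lt⟩
    exact one_ne_zero
  refine ⟨τ, hτ, fun x => ?_, ⟨e.symm (Pi.single 1 1), fun h => ?_⟩⟩
  · apply e.injective
    funext i
    fin_cases i
    · simp only [Fin.zero_eta, Fin.isValue]
      rw [(hcoord _).1, map_sub, Pi.sub_apply, Pi.sub_apply, (hcoord x).1, (hcoord x).2]
      ring
    · simp only [Fin.mk_one, Fin.isValue]
      rw [(hcoord _).2]
  · have h0 := (hcoord (e.symm (Pi.single 1 1))).1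
    rw [h, AddEquiv.apply_symm_apply] at h0
    simp at h0

/-- **surj(p), `p` odd ⟹ `E[p]/(τ − 1)E[p] ≃+ ℤ/p` for some `τ ∈ [Γ_ℚ, Γ_ℚ]`** — Mazur–Rubin (H.2)
/ Rubin's `Hyp(ℚ, E[p])` (a) / Sakamoto (H.2) at `α = 1` for the RESIDUAL representation
`T̄ = E[p]`, `R = 𝔽_p`, with `τ` in the commutator subgroup. In the frame of
`exists_mem_commutator_frame_shear_of_surj`, `(τ − 1)x` has coordinates `(e(x)₁, 0)`, so the image
of `τ − 1` is the kernel of the second coordinate `E[p] ↠ 𝔽_p`.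
[cite: Sakamoto2024, §2 hypothesis (H.2) (p. 921)] [cite: Serre1972, §5.2] -/
theorem exists_mem_commutator_torsion_quotient_equiv_zmod_of_surj (hp2 : p ≠ 2) (hs : Surj W p) :
    ∃ τ : absoluteGaloisGroup ℚ, τ ∈ commutator (absoluteGaloisGroup ℚ) ∧
      Nonempty ((geomTorsion W p ⧸
        ((Multiplicative.toAdd (galoisRepTorsion W p τ)).toAddMonoidHom -
          AddMonoidHom.id (geomTorsion W p)).range) ≃+ ZMod p) := by
  obtain ⟨e, τ, hτ, hcoord⟩ := exists_mem_commutator_frame_shear_of_surj W p hp2 hs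
  refine ⟨τ, hτ, ?_⟩
  set f : geomTorsion W p →+ geomTorsion W p :=
    (Multiplicative.toAdd (galoisRepTorsion W p τ)).toAddMonoidHom -
      AddMonoidHom.id (geomTorsion W p) with hf
  have hfx : ∀ x : geomTorsion W p, f x = τ • x - x := fun x => by
    rw [hf, AddMonoidHom.sub_apply, AddMonoidHom.id_apply, AddEquiv.coe_toAddMonoidHom]
    rfl
  -- the second coordinate `λ : E[p] →+ 𝔽_p`
  set lam : geomTorsion W p →+ ZMod p :=
    (Pi.evalAddMonoidHom (fun _ : Fin 2 => ZMod p) 1).comp e.toAddMonoidHom with hlam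
  have hlam_apply : ∀ x : geomTorsion W p, lam x = e x 1 := fun x => rfl
  have hsurj : Function.Surjective lam := fun y =>
    ⟨e.symm (fun _ => y), by rw [hlam_apply, AddEquiv.apply_symm_apply]⟩
  have hker : f.range = lam.ker := by
    apply le_antisymm
    · rintro _ ⟨y, rfl⟩
      rw [AddMonoidHom.mem_ker, hlam_apply, hfx, map_sub, Pi.sub_apply, (hcoord y).2, sub_self]
    · intro x hx
      rw [AddMonoidHom.mem_ker, hlam_apply] at hx
      refine ⟨e.symm (Pi.single 1 (e x 0)), ?_⟩
      rw [hfx]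
      apply e.injective
      rw [map_sub]
      funext i
      fin_cases i
      · simp only [Fin.zero_eta, Fin.isValue, Pi.sub_apply]
        rw [(hcoord _).1, AddEquiv.apply_symm_apply]
        simp
      · simp only [Fin.mk_one, Fin.isValue, Pi.sub_apply]
        rw [(hcoord _).2, sub_self, hx]
  exact ⟨(QuotientAddGroup.quotientAddEquivOfEq hker).trans
    (QuotientAddGroup.quotientKerEquivOfSurjective lam hsurj)⟩

/-- **The same `τ` fixes every root of unity.** surj(p), `p` odd ⟹ there is `τ ∈ Γ_ℚ` fixing
every `t ∈ ℚ̄` with `t^N = 1`, for every `N ≥ 1` (`τ ∈ [Γ_ℚ, Γ_ℚ] ≤ Gal(ℚ̄/ℚ(μ_N))`, the tree's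
`commutator_le_rootsOfUnityFixer`), with `E[p]/(τ − 1)E[p] ≃+ ℤ/p`. So `τ ∈ G_{ℚ^{ab}} ⊆
G_{ℚ(μ_{p^∞})}`: Rubin's `Hyp(ℚ, E[p])` (a) verbatim. [cite: Sakamoto2024, §2 hypothesis (H.2) (p. 921)] -/
theorem exists_rootsOfUnityFixing_torsion_quotient_equiv_zmod_of_surj (hp2 : p ≠ 2) (hs : Surj W p) :
    ∃ τ : absoluteGaloisGroup ℚ,
      (∀ N : ℕ, N ≠ 0 → ∀ t : AlgebraicClosure ℚ, t ^ N = 1 → τ • t = t) ∧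
      Nonempty ((geomTorsion W p ⧸
        ((Multiplicative.toAdd (galoisRepTorsion W p τ)).toAddMonoidHom -
          AddMonoidHom.id (geomTorsion W p)).range) ≃+ ZMod p) := by
  obtain ⟨τ, hτ, hq⟩ := exists_mem_commutator_torsion_quotient_equiv_zmod_of_surj W p hp2 hs
  refine ⟨τ, fun N hN t ht => ?_, hq⟩
  haveI : NeZero N := ⟨hN⟩
  haveI : NeZero (N : ℚ) := ⟨Nat.cast_ne_zero.mpr hN⟩
  exact (mem_rootsOfUnityFixer_iff.mp (commutator_le_rootsOfUnityFixer ℚ N hτ)) t ht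

/-- **(H.2) for `(E[p], 𝔽_p)` in the `p`-power shape of `BigImTorsionLevels`** (its level `m = 1`,
WITHOUT the tower): surj(p), `p` odd ⟹ `∃ τ` fixing every `p`-power root of unity with
`E[p]/(τ − 1)E[p] ≃+ ℤ/p`. [cite: Sakamoto2024, §2 hypothesis (H.2) (p. 921)] -/
theorem exists_torsion_quotient_equiv_zmod_of_surj (hp2 : p ≠ 2) (hs : Surj W p) :
    ∃ τ : absoluteGaloisGroup ℚ,
      (∀ (n : ℕ) (t : AlgebraicClosure ℚ), t ^ p ^ n = 1 → τ • t = t) ∧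
      Nonempty ((geomTorsion W p ⧸
        ((Multiplicative.toAdd (galoisRepTorsion W p τ)).toAddMonoidHom -
          AddMonoidHom.id (geomTorsion W p)).range) ≃+ ZMod p) := by
  obtain ⟨τ, hτ, hq⟩ := exists_rootsOfUnityFixing_torsion_quotient_equiv_zmod_of_surj W p hp2 hs
  exact ⟨τ, fun n t ht => hτ (p ^ n) (pow_ne_zero n hp.out.ne_zero) t ht, hq⟩

/-! ### (H.1) ∧ (H.2)_{T̄} ∧ (H.SD) for the residual representation -/

/-- **surj(p), `p` odd ⟹ (H.1) ∧ (H.2) ∧ (H.SD) for `(T̄, R) = (E[p], 𝔽_p)`.** (H.1) `E[p]` is an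
irreducible `Γ_ℚ`-module (`hasIrreducibleModPGaloisRep_of_hasSurjectiveModNGaloisRep`); (H.2) one
`τ ∈ Γ_ℚ` fixing every `p`-power root of unity with `E[p]/(τ − 1)E[p] ≃+ ℤ/p`
(`exists_torsion_quotient_equiv_zmod_of_surj`); (H.SD) the Weil pairing: a bilinear alternating
non-degenerate `Γ_ℚ`-equivariant `E[p] × E[p] → μ_p(ℚ̄)`, i.e. `E[p] ≅ E[p]^∨(1)` (tree theorem
`exists_weilPairing_holds`, Silverman *AEC* III.8.1). The shape is that of
`SakamotoHypothesesThree.sakamotoHypotheses_of_towerSurj` at its level `m = 1`, with the tower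
hypothesis replaced by surj(p). [cite: Sakamoto2024, §2 (H.1), (H.2), (H.SD) (p. 921)]
[cite: SilvermanAEC2009, Prop. III.8.1] -/
theorem residualHypotheses_of_surj (hp2 : p ≠ 2) (hs : Surj W p) :
    W.HasIrreducibleModPGaloisRep p ∧
    (∃ τ : absoluteGaloisGroup ℚ,
      (∀ (n : ℕ) (t : AlgebraicClosure ℚ), t ^ p ^ n = 1 → τ • t = t) ∧
      Nonempty ((geomTorsion W p ⧸
        ((Multiplicative.toAdd (galoisRepTorsion W p τ)).toAddMonoidHom -
          AddMonoidHom.id (geomTorsion W p)).range) ≃+ ZMod p)) ∧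
    (∃ w : geomTorsion W p → geomTorsion W p → AlgebraicClosure ℚ,
      (∀ S T, w S T ^ p = 1) ∧
      (∀ S₁ S₂ T, w (S₁ + S₂) T = w S₁ T * w S₂ T) ∧
      (∀ S T₁ T₂, w S (T₁ + T₂) = w S T₁ * w S T₂) ∧
      (∀ T, w T T = 1) ∧
      (∀ T, (∀ S, w S T = 1) → T = 0) ∧
      ∀ (σ : absoluteGaloisGroup ℚ) (S T : geomTorsion W p), σ • w S T = w (σ • S) (σ • T)) := by
  have hpP : p.Prime := hp.out
  haveI : NeZero p := ⟨hpP.ne_zero⟩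
  refine ⟨hasIrreducibleModPGaloisRep_of_hasSurjectiveModNGaloisRep W p hs,
    exists_torsion_quotient_equiv_zmod_of_surj W p hp2 hs, ?_⟩
  exact exists_weilPairing_holds W p hpP.two_le (Nat.cast_ne_zero.mpr hpP.ne_zero)

/-- **The N11 instance: on EVERY surj(3) row** (N11 = X4 ∧ r_an = 0 ∧ `p = 3` ∧ surj(3), any
reduction subtype, tower or not) the level-`1` Kolyvagin hypotheses (H.1) ∧ (H.2) ∧ (H.SD) for
`(E[3], 𝔽₃)` hold. [cite: Sakamoto2024, §2 (H.1), (H.2), (H.SD) (p. 921)] [cite: SilvermanAEC2009, Prop. III.8.1] -/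
theorem residualHypotheses_three_of_surj (hs : Surj W 3) :
    W.HasIrreducibleModPGaloisRep 3 ∧
    (∃ τ : absoluteGaloisGroup ℚ,
      (∀ (n : ℕ) (t : AlgebraicClosure ℚ), t ^ 3 ^ n = 1 → τ • t = t) ∧
      Nonempty ((geomTorsion W 3 ⧸
        ((Multiplicative.toAdd (galoisRepTorsion W 3 τ)).toAddMonoidHom -
          AddMonoidHom.id (geomTorsion W 3)).range) ≃+ ZMod 3)) ∧
    (∃ w : geomTorsion W 3 → geomTorsion W 3 → AlgebraicClosure ℚ,
      (∀ S T, w S T ^ 3 = 1) ∧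
      (∀ S₁ S₂ T, w (S₁ + S₂) T = w S₁ T * w S₂ T) ∧
      (∀ S T₁ T₂, w S (T₁ + T₂) = w S T₁ * w S T₂) ∧
      (∀ T, w T T = 1) ∧
      (∀ T, (∀ S, w S T = 1) → T = 0) ∧
      ∀ (σ : absoluteGaloisGroup ℚ) (S T : geomTorsion W 3), σ • w S T = w (σ • S) (σ • T)) := by
  haveI : Fact (Nat.Prime 3) := ⟨Nat.prime_three⟩
  exact residualHypotheses_of_surj W 3 (by decide) hs

/-- **EXOTIC rows: level `1` holds, (im) fails.** On an EXOTIC row (surj(3) ∧ ¬surj(9): Elkies'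
`9`-deficient `3`-adic image) the residual hypotheses (H.1) ∧ (H.2)_{E[3]} ∧ (H.SD) HOLD, while the
adic / level-`≥ 2` hypothesis (im) `Rank1Residual.BigIm W 3` (Kato 13.4 (3), BCS (im), Mazur–Rubin
(H.2) for `T₃E`) FAILS (`not_bigIm_of_surj_three_of_not_surj_nine`): the Elkies corner obstructs the
printed Kolyvagin-system machinery exactly through levels `k ≥ 2`, not at level `1`.
[cite: Sakamoto2024, §2 (H.1), (H.2), (H.SD) (p. 921)] [cite: Kato2004Asterisque, Thm. 13.4 (3) (p. 226), hypothesis] -/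
theorem residualHypotheses_and_not_bigIm_of_exotic (hs : Surj W 3)
    (h9 : ¬ W.HasSurjectiveModNGaloisRep 9) :
    (W.HasIrreducibleModPGaloisRep 3 ∧
      (∃ τ : absoluteGaloisGroup ℚ,
        (∀ (n : ℕ) (t : AlgebraicClosure ℚ), t ^ 3 ^ n = 1 → τ • t = t) ∧
        Nonempty ((geomTorsion W 3 ⧸
          ((Multiplicative.toAdd (galoisRepTorsion W 3 τ)).toAddMonoidHom -
            AddMonoidHom.id (geomTorsion W 3)).range) ≃+ ZMod 3)) ∧
      (∃ w : geomTorsion W 3 → geomTorsion W 3 → AlgebraicClosure ℚ,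
        (∀ S T, w S T ^ 3 = 1) ∧
        (∀ S₁ S₂ T, w (S₁ + S₂) T = w S₁ T * w S₂ T) ∧
        (∀ S T₁ T₂, w S (T₁ + T₂) = w S T₁ * w S T₂) ∧
        (∀ T, w T T = 1) ∧
        (∀ T, (∀ S, w S T = 1) → T = 0) ∧
        ∀ (σ : absoluteGaloisGroup ℚ) (S T : geomTorsion W 3), σ • w S T = w (σ • S) (σ • T))) ∧
    ¬ BigIm W 3 :=
  ⟨residualHypotheses_three_of_surj W hs, not_bigIm_of_surj_three_of_not_surj_nine W hs h9⟩

end Summit.BirchSwinnertonDyer.Rank1Residual.GaloisImage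

end
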